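import Summits.RiemannHypothesis.RiemannHypothesis.Theorems.TiltedLandingLaw421R3SinkEndsKink
import Summits.RiemannHypothesis.RiemannHypothesis.Theorems.TiltedLandingLaw421R3SinkScale

/-!
# «SinkTwo» v1 — WINDOW NORMALISATION `R = 2` of the right-sided corner-dominance conjectures, and the EXACT `(δ, t, h)`-BOX they quantify over
(C1 desk, rh-idea-5 g40; files-only; SUPPORT, K only — typing on call for C3's `R = 2` certificate programme (#1272, #1278, K1Lid*, K1Bdry))

TWO imports: TREE #1277 «SinkEndsKink» (126: the real closed forms `CornerDominanceRRealSig` / `…EndsRRealSig` / `…KinkRRealSig`, `KinkWeightForm`)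
and TREE #1270 «SinkScale» (118: `pairCForm_scale`, `twoPointNForm_scale`, `cornerSigmaForm_scale`, `bdryDomForm_scale`).  Namespace `RhW08.SinkTwo`;
nothing re-declared.  (K) only, asserts no law: every conjecture below is a `def … : Prop`, and the theorems are equivalences between conjectures.
* §1 `kinkWeightForm_scale`: the kink condition is dilation invariant (both corner ratios `N/c` are degree 0).
* §2 `forall_window_iff_two`: for any dilation-invariant predicate `P R δ t h`, the eleven-binder block of 113/126's right-sided conjectures
  (`0 < s`, `6s ≤ R`, `3h < R`, `0 < Y ≤ h`, `0 < t < Y`, `Y − s/4 < t`, `δ² + t² ≤ Y²`, strict cone, `0 ≤ δ`) is equivalent to its `R = 2`, `s = 1/3`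
  specialisation (`3h < 2`, `Y ≤ h`, `0 < t < Y`, `Y − 1/12 < t`, `δ² + t² ≤ Y²`, `δ(2 − δ) < t²`, `0 ≤ δ`): scale by `c = 2/R`; `s = 1/3` is extremal.
* §3 the three conjectures at `R = 2` (`CornerDominanceRTwoSig`, `…EndsRTwoSig`, `…KinkRTwoSig`) and ★ the equivalences with 126's general-`R` forms.
* §4 ONE WEIGHT AT A TIME: `EndsHalfRRealSig y0` (the `y0`-half of 126's end-weight conjecture; `cornerDominanceEndsRRealSig_iff_halves`) and
  ★ `endsHalfRRealSig_iff_box`: eliminating the window AND the drop datum `Y`, the half conjecture is EXACTLY the statement that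
  `BdryDomForm 2 δ t h y0 σ*` holds on the box `0 ≤ δ`, `0 < t < h < 2/3`, `δ² + t² ≤ h²`, `δ² < t/6 + 1/144`, `δ(2 − δ) < t²` (the projection of the
  binder block; witness `Y = max (√(δ² + t²)) ((t + min h (t + 1/12))/2)`).  On the box the cone caps `δ`: `t < 2/3 ⇒ δ < 33/128`
  (`endsBox_delta_lt_main`), `t < 1/8 ⇒ δ < 129/16384` (`endsBox_delta_lt_small`) — so C3's two certificate boxes MAIN `[1/8, 2/3] × [0, 33/128]`
  (#1272 / #1278 / 130–134) and SMALL `[0, 1/8] × [0, 129/16384]` ((CA1052)(1)(B)) COVER it: ★ `endsHalfRRealSig_of_pieces` (pieces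
  `EndsPiece y0 tlo thi dhi`) is «K1EndsOne»'s last line typed, and `cornerDominanceEndsRSig_of_pieces` returns all four pieces to 113's
  `CornerDominanceEndsRSig`.
LEVEL: SUPPORT (K).  No `sorry`.  Nothing here bears on the truth of RH; RH is not proved; ⟨33346⟩/⟨33347⟩ OPEN; `CornerDominanceRSig` and its `R = 2`
forms are OPEN conjectures; checked ≠ keyed ≠ landed ≠ proved.
-/

noncomputable section

open RhW08.SinkBdry RhW08.SinkScale RhW08.SinkEndsKink

namespace RhW08.SinkTwo

/-! ## §1 The kink condition is dilation invariant -/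

/-- `KinkWeightForm (cR) (cδ) (ct) (ch) y0 ↔ KinkWeightForm R δ t h y0` for `c ≠ 0`: numerator and denominator of each corner ratio scale by `c⁻¹`. -/
theorem kinkWeightForm_scale (c R δ t h y0 : ℝ) (hc : c ≠ 0) :
    KinkWeightForm (c * R) (c * δ) (c * t) (c * h) y0 ↔ KinkWeightForm R δ t h y0 := by
  unfold KinkWeightForm
  have h1 : c * R / 2 = c * (R / 2) := by ring
  have h2 : -(c * (R / 2)) = c * (-(R / 2)) := by ring
  rw [h1, h2, twoPointNForm_scale c δ t h y0 (R / 2) (R / 2) hc, pairCForm_scale c δ t (R / 2) (R / 2) hc,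
    twoPointNForm_scale c δ t h y0 (-(R / 2)) (R / 2) hc, pairCForm_scale c δ t (-(R / 2)) (R / 2) hc,
    mul_div_mul_left _ _ (inv_ne_zero hc), mul_div_mul_left _ _ (inv_ne_zero hc)]

/-! ## §2 The binder block normalised to `R = 2`, `s = 1/3` -/

/-- WINDOW NORMALISATION: for a predicate invariant under the dilation `(R, δ, t, h) ↦ (cR, cδ, ct, ch)`, `0 < c`, the binder block of the right-sided
conjectures at a general window `R` (scale `s`, drop datum `Y`) is equivalent to its specialisation `R = 2`, `s = 1/3` (cone `δ(2 − δ) < t²` for `0 ≤ δ`). -/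
theorem forall_window_iff_two (P : ℝ → ℝ → ℝ → ℝ → Prop) (hP : ∀ c R δ t h : ℝ, 0 < c → (P (c * R) (c * δ) (c * t) (c * h) ↔ P R δ t h)) :
    (∀ R s h δ t Y : ℝ, 0 < s → 6 * s ≤ R → 3 * h < R → 0 < Y → Y ≤ h → 0 < t → t < Y → Y - s / 4 < t → δ ^ 2 + t ^ 2 ≤ Y ^ 2 →
        |δ| * (R - |δ|) < t ^ 2 → 0 ≤ δ → P R δ t h) ↔
      (∀ h δ t Y : ℝ, 3 * h < 2 → Y ≤ h → 0 < t → t < Y → Y - 1 / 12 < t → δ ^ 2 + t ^ 2 ≤ Y ^ 2 → δ * (2 - δ) < t ^ 2 → 0 ≤ δ → P 2 δ t h) := by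
  constructor
  · intro H h δ t Y h3 hYh ht htY hdrop hnest hcone hδ
    refine H 2 (1 / 3) h δ t Y (by norm_num) (by norm_num) h3 (ht.trans htY) hYh ht htY (by linarith) hnest ?_ hδ
    rw [abs_of_nonneg hδ]
    exact hcone
  · intro H R s h δ t Y hs hR h3 hY hYh ht htY hdrop hnest hcone hδ
    have hRpos : 0 < R := by linarith
    have hc : 0 < 2 / R := div_pos two_pos hRpos
    have hcR : 2 / R * R = 2 := div_mul_cancel₀ 2 hRpos.ne'
    have hcone' : δ * (R - δ) < t ^ 2 := by rw [abs_of_nonneg hδ] at hcone; exact hcone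
    have e3 : 3 * (2 / R * h) < 2 :=
      calc 3 * (2 / R * h) = 2 / R * (3 * h) := by ring
        _ < 2 / R * R := mul_lt_mul_of_pos_left h3 hc
        _ = 2 := hcR
    have e5 : 2 / R * Y - 1 / 12 < 2 / R * t := by
      have d1 : 2 / R * (Y - s / 4) < 2 / R * t := mul_lt_mul_of_pos_left hdrop hc
      have d2 : 2 / R * (6 * s) ≤ 2 / R * R := mul_le_mul_of_nonneg_left hR hc.le
      rw [hcR] at d2
      nlinarith [d1, d2]
    have e6 : (2 / R * δ) ^ 2 + (2 / R * t) ^ 2 ≤ (2 / R * Y) ^ 2 :=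
      calc (2 / R * δ) ^ 2 + (2 / R * t) ^ 2 = (2 / R) ^ 2 * (δ ^ 2 + t ^ 2) := by ring
        _ ≤ (2 / R) ^ 2 * Y ^ 2 := mul_le_mul_of_nonneg_left hnest (sq_nonneg _)
        _ = (2 / R * Y) ^ 2 := by ring
    have e7 : 2 / R * δ * (2 - 2 / R * δ) < (2 / R * t) ^ 2 :=
      calc 2 / R * δ * (2 - 2 / R * δ) = 2 / R * δ * (2 / R * R - 2 / R * δ) := by rw [hcR]
        _ = (2 / R) ^ 2 * (δ * (R - δ)) := by ring
        _ < (2 / R) ^ 2 * t ^ 2 := mul_lt_mul_of_pos_left hcone' (pow_pos hc 2)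
        _ = (2 / R * t) ^ 2 := by ring
    have key := H (2 / R * h) (2 / R * δ) (2 / R * t) (2 / R * Y) e3 (mul_le_mul_of_nonneg_left hYh hc.le) (mul_pos hc ht)
      (mul_lt_mul_of_pos_left htY hc) e5 e6 e7 (mul_nonneg hc.le hδ)
    have key' : P (2 / R * R) (2 / R * δ) (2 / R * t) (2 / R * h) := by rw [hcR]; exact key
    exact (hP (2 / R) R δ t h hc).1 key'

/-! ## §3 The right-sided conjectures at the window `R = 2` -/

/-- RIGHT-SIDED CORNER DOMINANCE AT `R = 2` (a CONJECTURE, not proved here; ↔ 126's `CornerDominanceRRealSig` by `cornerDominanceRRealSig_iff_two`):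
for every child `(δ, t)` of the normalised binder block and every weight `y0 ∈ [0, 1]`, `BdryDomForm 2 δ t h y0 (cornerSigmaForm 2 δ t h y0)`. -/
def CornerDominanceRTwoSig : Prop :=
  ∀ (h δ t Y : ℝ), 3 * h < 2 → Y ≤ h → 0 < t → t < Y → Y - 1 / 12 < t → δ ^ 2 + t ^ 2 ≤ Y ^ 2 → δ * (2 - δ) < t ^ 2 → 0 ≤ δ →
    ∀ y0 : ℝ, 0 ≤ y0 → y0 ≤ 1 → BdryDomForm 2 δ t h y0 (cornerSigmaForm 2 δ t h y0)

/-- RIGHT-SIDED CORNER DOMINANCE AT THE END WEIGHTS, `R = 2` (a CONJECTURE; ↔ 126's `CornerDominanceEndsRRealSig` by `cornerDominanceEndsRRealSig_iff_two`;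
the `y0 = 1` conjunct is the target of C3's K1 programme #1272 / #1278 / K1Lid* / K1Bdry on its MAIN box). -/
def CornerDominanceEndsRTwoSig : Prop :=
  ∀ (h δ t Y : ℝ), 3 * h < 2 → Y ≤ h → 0 < t → t < Y → Y - 1 / 12 < t → δ ^ 2 + t ^ 2 ≤ Y ^ 2 → δ * (2 - δ) < t ^ 2 → 0 ≤ δ →
    BdryDomForm 2 δ t h 0 (cornerSigmaForm 2 δ t h 0) ∧ BdryDomForm 2 δ t h 1 (cornerSigmaForm 2 δ t h 1)

/-- RIGHT-SIDED CORNER DOMINANCE AT THE KINK WEIGHT, `R = 2` (a CONJECTURE; ↔ 126's `CornerDominanceKinkRRealSig` by `cornerDominanceKinkRRealSig_iff_two`). -/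
def CornerDominanceKinkRTwoSig : Prop :=
  ∀ (h δ t Y : ℝ), 3 * h < 2 → Y ≤ h → 0 < t → t < Y → Y - 1 / 12 < t → δ ^ 2 + t ^ 2 ≤ Y ^ 2 → δ * (2 - δ) < t ^ 2 → 0 ≤ δ →
    ∀ y0 : ℝ, 0 < y0 → y0 < 1 → KinkWeightForm 2 δ t h y0 → BdryDomForm 2 δ t h y0 (cornerSigmaForm 2 δ t h y0)

/-- ★ `CornerDominanceRRealSig ↔ CornerDominanceRTwoSig`: the window may be normalised to `R = 2` (and the scale to `s = 1/3`) without loss. -/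
theorem cornerDominanceRRealSig_iff_two : CornerDominanceRRealSig ↔ CornerDominanceRTwoSig := by
  have step : CornerDominanceRRealSig ↔
      (∀ R s h δ t Y : ℝ, 0 < s → 6 * s ≤ R → 3 * h < R → 0 < Y → Y ≤ h → 0 < t → t < Y → Y - s / 4 < t → δ ^ 2 + t ^ 2 ≤ Y ^ 2 →
        |δ| * (R - |δ|) < t ^ 2 → 0 ≤ δ → ∀ y0 : ℝ, 0 ≤ y0 → y0 ≤ 1 → BdryDomForm R δ t h y0 (cornerSigmaForm R δ t h y0)) := by
    constructor
    · intro H R s h δ t Y hs hR h3 hY hYh ht htY hdrop hnest hcone hδ y0 hy0 hy1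
      exact H R s h y0 δ t Y hs hR h3 hY hYh ht htY hdrop hnest hcone hδ hy0 hy1
    · intro H R s h y0 δ t Y hs hR h3 hY hYh ht htY hdrop hnest hcone hδ hy0 hy1
      exact H R s h δ t Y hs hR h3 hY hYh ht htY hdrop hnest hcone hδ y0 hy0 hy1
  rw [step]
  refine forall_window_iff_two (fun R δ t h => ∀ y0 : ℝ, 0 ≤ y0 → y0 ≤ 1 → BdryDomForm R δ t h y0 (cornerSigmaForm R δ t h y0)) ?_
  intro c R δ t h hc
  simp only [cornerSigmaForm_scale c R δ t h _ hc.ne', bdryDomForm_scale c R δ t h _ _ hc]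

/-- ★ `CornerDominanceEndsRRealSig ↔ CornerDominanceEndsRTwoSig`. -/
theorem cornerDominanceEndsRRealSig_iff_two : CornerDominanceEndsRRealSig ↔ CornerDominanceEndsRTwoSig := by
  refine forall_window_iff_two
    (fun R δ t h => BdryDomForm R δ t h 0 (cornerSigmaForm R δ t h 0) ∧ BdryDomForm R δ t h 1 (cornerSigmaForm R δ t h 1)) ?_
  intro c R δ t h hc
  simp only [cornerSigmaForm_scale c R δ t h _ hc.ne', bdryDomForm_scale c R δ t h _ _ hc]

/-- ★ `CornerDominanceKinkRRealSig ↔ CornerDominanceKinkRTwoSig`. -/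
theorem cornerDominanceKinkRRealSig_iff_two : CornerDominanceKinkRRealSig ↔ CornerDominanceKinkRTwoSig := by
  have step : CornerDominanceKinkRRealSig ↔
      (∀ R s h δ t Y : ℝ, 0 < s → 6 * s ≤ R → 3 * h < R → 0 < Y → Y ≤ h → 0 < t → t < Y → Y - s / 4 < t → δ ^ 2 + t ^ 2 ≤ Y ^ 2 →
        |δ| * (R - |δ|) < t ^ 2 → 0 ≤ δ →
        ∀ y0 : ℝ, 0 < y0 → y0 < 1 → KinkWeightForm R δ t h y0 → BdryDomForm R δ t h y0 (cornerSigmaForm R δ t h y0)) := by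
    constructor
    · intro H R s h δ t Y hs hR h3 hY hYh ht htY hdrop hnest hcone hδ y0 hy0 hy1 hk
      exact H R s h y0 δ t Y hs hR h3 hY hYh ht htY hdrop hnest hcone hδ hy0 hy1 hk
    · intro H R s h y0 δ t Y hs hR h3 hY hYh ht htY hdrop hnest hcone hδ hy0 hy1 hk
      exact H R s h δ t Y hs hR h3 hY hYh ht htY hdrop hnest hcone hδ y0 hy0 hy1 hk
  rw [step]
  refine forall_window_iff_two
    (fun R δ t h => ∀ y0 : ℝ, 0 < y0 → y0 < 1 → KinkWeightForm R δ t h y0 → BdryDomForm R δ t h y0 (cornerSigmaForm R δ t h y0)) ?_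
  intro c R δ t h hc
  simp only [kinkWeightForm_scale c R δ t h _ hc.ne', cornerSigmaForm_scale c R δ t h _ hc.ne', bdryDomForm_scale c R δ t h _ _ hc]

/-- the `R = 2` corner dominance at every weight gives it at the end weights and at the kink weight (the converse reduction is 113's
`cornerDominanceRSig_of_ends_of_kink`, transported by 126's three equivalences and the three above). -/
theorem cornerDominanceRTwoSig_ends_and_kink (H : CornerDominanceRTwoSig) : CornerDominanceEndsRTwoSig ∧ CornerDominanceKinkRTwoSig := by
  refine ⟨fun h δ t Y h3 hYh ht htY hdrop hnest hcone hδ => ?_, fun h δ t Y h3 hYh ht htY hdrop hnest hcone hδ y0 hy0 hy1 _ => ?_⟩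
  · exact ⟨H h δ t Y h3 hYh ht htY hdrop hnest hcone hδ 0 le_rfl zero_le_one, H h δ t Y h3 hYh ht htY hdrop hnest hcone hδ 1 zero_le_one le_rfl⟩
  · exact H h δ t Y h3 hYh ht htY hdrop hnest hcone hδ y0 hy0.le hy1.le

/-- 113's reduction at `R = 2`: `CornerDominanceEndsRTwoSig → CornerDominanceKinkRTwoSig → CornerDominanceRTwoSig` (via 113's
`cornerDominanceRSig_of_ends_of_kink` and the six equivalences). -/
theorem cornerDominanceRTwoSig_of_ends_of_kink (hE : CornerDominanceEndsRTwoSig) (hK : CornerDominanceKinkRTwoSig) : CornerDominanceRTwoSig :=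
  cornerDominanceRRealSig_iff_two.1 (cornerDominanceRSig_iff.1 (RhW08.SinkCornerReduction.cornerDominanceRSig_of_ends_of_kink
    (cornerDominanceEndsRSig_iff.2 (cornerDominanceEndsRRealSig_iff_two.2 hE)) (cornerDominanceKinkRSig_iff.2 (cornerDominanceKinkRRealSig_iff_two.2 hK))))

/-! ## §4 The end-weight conjecture ONE WEIGHT AT A TIME, on an explicit `(δ, t, h)` box, and the MAIN/SMALL dispatcher -/

/-- ONE HALF of 126's `CornerDominanceEndsRRealSig`: the end-weight conjecture at the single weight `y0` (used at `y0 = 0` and `y0 = 1`; a CONJECTURE for each;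
general window `R`).  C3's «K1EndsOne» ((CA1052)(1)) is `EndsHalfRRealSig 1`. -/
def EndsHalfRRealSig (y0 : ℝ) : Prop :=
  ∀ (R s h δ t Y : ℝ),
    0 < s → 6 * s ≤ R → 3 * h < R → 0 < Y → Y ≤ h →
    0 < t → t < Y → Y - s / 4 < t → δ ^ 2 + t ^ 2 ≤ Y ^ 2 →
    |δ| * (R - |δ|) < t ^ 2 → 0 ≤ δ → BdryDomForm R δ t h y0 (cornerSigmaForm R δ t h y0)

/-- `CornerDominanceEndsRRealSig ↔ EndsHalfRRealSig 0 ∧ EndsHalfRRealSig 1`. -/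
theorem cornerDominanceEndsRRealSig_iff_halves : CornerDominanceEndsRRealSig ↔ EndsHalfRRealSig 0 ∧ EndsHalfRRealSig 1 := by
  constructor
  · intro H
    exact ⟨fun R s h δ t Y hs hR h3 hY hYh ht htY hdrop hnest hcone hδ => (H R s h δ t Y hs hR h3 hY hYh ht htY hdrop hnest hcone hδ).1,
      fun R s h δ t Y hs hR h3 hY hYh ht htY hdrop hnest hcone hδ => (H R s h δ t Y hs hR h3 hY hYh ht htY hdrop hnest hcone hδ).2⟩
  · rintro ⟨H0, H1⟩ R s h δ t Y hs hR h3 hY hYh ht htY hdrop hnest hcone hδ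
    exact ⟨H0 R s h δ t Y hs hR h3 hY hYh ht htY hdrop hnest hcone hδ, H1 R s h δ t Y hs hR h3 hY hYh ht htY hdrop hnest hcone hδ⟩

/-- THE HALF CONJECTURE ON THE BOX (a CONJECTURE for each `y0`; ↔ `EndsHalfRRealSig y0` by `endsHalfRRealSig_iff_box`): for `0 ≤ δ`, `0 < t < h < 2/3`,
`δ² + t² ≤ h²`, `δ² < t/6 + 1/144`, `δ(2 − δ) < t²`: `BdryDomForm 2 δ t h y0 (cornerSigmaForm 2 δ t h y0)`. -/
def EndsHalfBoxSig (y0 : ℝ) : Prop :=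
  ∀ (δ t h : ℝ), 0 ≤ δ → 0 < t → t < h → 3 * h < 2 → δ ^ 2 + t ^ 2 ≤ h ^ 2 → δ ^ 2 < t / 6 + 1 / 144 → δ * (2 - δ) < t ^ 2 →
    BdryDomForm 2 δ t h y0 (cornerSigmaForm 2 δ t h y0)

/-- the drop datum recovered from a box point: `Y = max (√(δ² + t²)) ((t + min h (t + 1/12))/2)` satisfies the normalised binder block. -/
theorem endsBox_witness {δ t h : ℝ} (ht : 0 < t) (hth : t < h) (hH : δ ^ 2 + t ^ 2 ≤ h ^ 2) (hW : δ ^ 2 < t / 6 + 1 / 144) :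
    ∃ Y : ℝ, Y ≤ h ∧ t < Y ∧ Y - 1 / 12 < t ∧ δ ^ 2 + t ^ 2 ≤ Y ^ 2 := by
  set r := Real.sqrt (δ ^ 2 + t ^ 2) with hr_def
  have hr0 : 0 ≤ r := Real.sqrt_nonneg _
  have hrsq : r ^ 2 = δ ^ 2 + t ^ 2 := Real.sq_sqrt (by positivity)
  have hh : 0 ≤ h := by linarith
  have hrh : r ≤ h :=
    calc r ≤ Real.sqrt (h ^ 2) := Real.sqrt_le_sqrt hH
      _ = h := Real.sqrt_sq hh
  have hrt : r < t + 1 / 12 := (Real.sqrt_lt' (by linarith)).2 (by nlinarith [hW])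
  set m := min h (t + 1 / 12) with hm_def
  have hmt : t < m := lt_min hth (by linarith)
  have hmh : m ≤ h := min_le_left _ _
  have hm12 : m ≤ t + 1 / 12 := min_le_right _ _
  refine ⟨max r ((t + m) / 2), max_le hrh (by linarith), lt_of_lt_of_le (by linarith) (le_max_right _ _), ?_, ?_⟩
  · have : max r ((t + m) / 2) < t + 1 / 12 := max_lt hrt (by linarith)
    linarith
  · rw [← hrsq]
    exact pow_le_pow_left₀ hr0 (le_max_left _ _) 2

/-- ★ `EndsHalfRRealSig y0 ↔ EndsHalfBoxSig y0`: normalise the window to `R = 2` (§2) and eliminate the drop datum `Y` (the box is exactly the projection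
of the normalised binder block to `(δ, t, h)`). -/
theorem endsHalfRRealSig_iff_box (y0 : ℝ) : EndsHalfRRealSig y0 ↔ EndsHalfBoxSig y0 := by
  have step : EndsHalfRRealSig y0 ↔
      (∀ h δ t Y : ℝ, 3 * h < 2 → Y ≤ h → 0 < t → t < Y → Y - 1 / 12 < t → δ ^ 2 + t ^ 2 ≤ Y ^ 2 → δ * (2 - δ) < t ^ 2 → 0 ≤ δ →
        BdryDomForm 2 δ t h y0 (cornerSigmaForm 2 δ t h y0)) := by
    refine forall_window_iff_two (fun R δ t h => BdryDomForm R δ t h y0 (cornerSigmaForm R δ t h y0)) ?_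
    intro c R δ t h hc
    simp only [cornerSigmaForm_scale c R δ t h _ hc.ne', bdryDomForm_scale c R δ t h _ _ hc]
  rw [step]
  constructor
  · intro H δ t h hδ ht hth h3 hH hW hcone
    obtain ⟨Y, hYh, htY, hdrop, hnest⟩ := endsBox_witness ht hth hH hW
    exact H h δ t Y h3 hYh ht htY hdrop hnest hcone hδ
  · intro H h δ t Y h3 hYh ht htY hdrop hnest hcone hδ
    have hY : 0 < Y := ht.trans htY
    have hY2 : Y ^ 2 ≤ h ^ 2 := pow_le_pow_left₀ hY.le hYh 2
    have hY3 : Y ^ 2 < (t + 1 / 12) ^ 2 := pow_lt_pow_left₀ (by linarith) hY.le two_ne_zero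
    exact H δ t h hδ ht (htY.trans_le hYh) h3 (hnest.trans hY2) (by nlinarith [hnest, hY3]) hcone

/-- THE CONE CAPS `δ` ON THE MAIN RANGE: a box point with `t < 2/3` has `δ < 33/128`, for any sign of `δ`
(because `δ(2 − δ) < t² < 4/9` and `(33/128)(2 − 33/128) > 4/9`). -/
theorem endsBox_delta_lt_main {δ t : ℝ} (hW : δ ^ 2 < t / 6 + 1 / 144) (hcone : δ * (2 - δ) < t ^ 2) (ht : t < 2 / 3) : δ < 33 / 128 := by
  have ht2 : t ^ 2 < 4 / 9 := by nlinarith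
  have hδ1 : δ < 1 := by nlinarith
  by_contra hc
  have hc' : 33 / 128 ≤ δ := not_lt.1 hc
  nlinarith [mul_nonneg (sub_nonneg.2 hc') (by linarith : (0:ℝ) ≤ 2 - δ - 33 / 128)]

/-- THE CONE CAPS `δ` ON THE SMALL-`t` RANGE: a box point with `t < 1/8` has `δ < 129/16384` (because `δ(2 − δ) < t² < 1/64` and
`(129/16384)(2 − 129/16384) > 1/64`). -/
theorem endsBox_delta_lt_small {δ t : ℝ} (hδ : 0 ≤ δ) (ht0 : 0 < t) (hW : δ ^ 2 < t / 6 + 1 / 144) (hcone : δ * (2 - δ) < t ^ 2) (ht : t < 1 / 8) :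
    δ < 129 / 16384 := by
  have ht2 : t ^ 2 < 1 / 64 := by nlinarith
  have hδ1 : δ < 1 := by nlinarith
  by_contra hc
  have hc' : 129 / 16384 ≤ δ := not_lt.1 hc
  nlinarith [mul_nonneg (sub_nonneg.2 hc') (by linarith : (0:ℝ) ≤ 2 - δ - 129 / 16384)]

/-- A PIECE of the half conjecture on the box: weight `y0`, closed `t`-range `[tlo, thi]`, closed `δ`-range `[0, dhi]`, the other box binders kept
(a CONJECTURE for each parameter choice; C3's boxes are MAIN `= EndsPiece y0 (1/8) (2/3) (33/128)` and SMALL `= EndsPiece y0 0 (1/8) (129/16384)`). -/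
def EndsPiece (y0 tlo thi dhi : ℝ) : Prop :=
  ∀ (δ t h : ℝ), 0 ≤ δ → δ ≤ dhi → tlo ≤ t → t ≤ thi → 0 < t → t < h → 3 * h < 2 → δ ^ 2 + t ^ 2 ≤ h ^ 2 → δ ^ 2 < t / 6 + 1 / 144 →
    δ * (2 - δ) < t ^ 2 → BdryDomForm 2 δ t h y0 (cornerSigmaForm 2 δ t h y0)

/-- a closed-box statement with no binders beyond the ranges and the cone gives the piece (e.g. C3's `h`-free MAIN theorem 134 `bdryDomForm_two_K1_main`
gives `EndsPiece 1 (1/8) (2/3) (33/128)` after reordering its hypotheses). -/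
theorem endsPiece_of_forall {y0 tlo thi dhi : ℝ}
    (H : ∀ δ t h : ℝ, 0 ≤ δ → δ ≤ dhi → tlo ≤ t → t ≤ thi → δ * (2 - δ) < t ^ 2 → BdryDomForm 2 δ t h y0 (cornerSigmaForm 2 δ t h y0)) :
    EndsPiece y0 tlo thi dhi :=
  fun δ t h hδ hdhi htlo hthi _ _ _ _ _ hcone => H δ t h hδ hdhi htlo hthi hcone

/-- ★ THE DISPATCHER: the pieces MAIN `[1/8, 2/3] × [0, 33/128]` and SMALL `[0, 1/8] × [0, 129/16384]` cover the box, so they give the half conjecture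
on the box at the same weight. -/
theorem endsHalfBoxSig_of_pieces {y0 : ℝ} (hM : EndsPiece y0 (1 / 8) (2 / 3) (33 / 128)) (hS : EndsPiece y0 0 (1 / 8) (129 / 16384)) :
    EndsHalfBoxSig y0 := by
  intro δ t h hδ ht hth h3 hH hW hcone
  have ht23 : t < 2 / 3 := by linarith
  rcases le_or_gt (1 / 8 : ℝ) t with hmain | hsmall
  · exact hM δ t h hδ (endsBox_delta_lt_main hW hcone ht23).le hmain ht23.le ht hth h3 hH hW hcone
  · exact hS δ t h hδ (endsBox_delta_lt_small hδ ht hW hcone hsmall).le ht.le hsmall.le ht hth h3 hH hW hcone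

/-- ★ «K1EndsOne»'S LAST LINE, typed: MAIN + SMALL at weight `y0` ⇒ `EndsHalfRRealSig y0` — the `y0`-half of 126's `CornerDominanceEndsRRealSig` AT EVERY
window `R` (118's scaling is inside `endsHalfRRealSig_iff_box`). -/
theorem endsHalfRRealSig_of_pieces {y0 : ℝ} (hM : EndsPiece y0 (1 / 8) (2 / 3) (33 / 128)) (hS : EndsPiece y0 0 (1 / 8) (129 / 16384)) :
    EndsHalfRRealSig y0 :=
  (endsHalfRRealSig_iff_box y0).2 (endsHalfBoxSig_of_pieces hM hS)

/-- the four pieces MAIN/SMALL × `y0 ∈ {0, 1}` give 113's `CornerDominanceEndsRSig` (so of `C′ = Ends ∧ Kink` only the kink half would remain). -/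
theorem cornerDominanceEndsRSig_of_pieces (hM0 : EndsPiece 0 (1 / 8) (2 / 3) (33 / 128)) (hS0 : EndsPiece 0 0 (1 / 8) (129 / 16384))
    (hM1 : EndsPiece 1 (1 / 8) (2 / 3) (33 / 128)) (hS1 : EndsPiece 1 0 (1 / 8) (129 / 16384)) : RhW08.SinkCornerReduction.CornerDominanceEndsRSig :=
  cornerDominanceEndsRSig_iff.2 (cornerDominanceEndsRRealSig_iff_halves.2 ⟨endsHalfRRealSig_of_pieces hM0 hS0, endsHalfRRealSig_of_pieces hM1 hS1⟩)

end RhW08.SinkTwo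

end
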